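import Summits.BirchSwinnertonDyer.BirchSwinnertonDyer.Theses.PlecticLegs
import Literature.NumberTheory.EllipticCurves.NonvanishingTwistsHoffsteinLuo
import Literature.NumberTheory.EllipticCurves.BSDRootNumberNoContinuationProofs

/-!
# `PlecticLegs.TwistSupply` (crux stmt-BirchSwinnertonDyer-18260): load-bearing analysis of its
# only hypothesis `2 ≤ W.analyticRank` (negative-side support from the standing disprover seat;
# this file does NOT refute the crux)

The crux reads `∀ W elliptic, 2 ≤ r_an(W) → C(W, r_an(W))`, where `C(W, r)` ("silent field of degree
`r`") is: some level `m` and subgroup `H ≤ Gal(ℚ(ζ_m)/ℚ)` with totally real fixed field of degree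
`r` all of whose non-trivial characters `χ` (mod `m`, trivial on `H`) have `L(W, χ, 1) ≠ 0`. All
statements below spell `C` out inline, verbatim from the route file.

* `twistSupply_conclusion_false_at_degree_zero` — `C(W, 0)` is unsatisfiable for every `W` (a field
  has positive degree): unconditional.
* `twistSupply_conclusion_at_degree_one` — `C(W, 1)` holds for every `W` (`m = 1`, `H = ⊤`, fixed
  field `ℚ`, no non-trivial character of level `1`): unconditional, no `L`-value enters.
* `twistSupply_imp_of_one_le_analyticRank` — hence the crux already gives its conclusion from the
  weaker threshold `1 ≤ r_an(W)` (MUTATION: the hypothesis is not used at `r_an = 1`).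
* `twistSupply_false_without_rank_of_exists_analyticRank_zero` — the crux with the hypothesis
  DROPPED is false as soon as one elliptic curve over `ℚ` of analytic rank `0` is available, and
  `twistSupply_false_without_rank_of_hoffsteinLuo` supplies one from the catalogued named fact
  `HoffsteinLuo1997_exists_twist_L_one_ne_zero` (Hoffstein–Luo 1997, the crux's own `r = 2`
  input): a quadratic twist with `L(E^{(d)}, 1) ≠ 0` has `r_an = 0` unconditionally (the order of
  a non-vanishing germ, or Mathlib's junk order, is `0`).
* `forall_analyticRank_ne_zero_of_twistSupply_without_rank` /
  `hasEntireLFunction_rat_of_twistSupply_without_rank` — what the dropped hypothesis would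
  smuggle in: `r_an ≠ 0` for every curve, hence (tree theorem
  `hasEntireLFunction_of_analyticRank_ne_zero`, the unconditional disposal of the junk branch) the
  entire continuation of `L(E, s)` for EVERY `E/ℚ`.

Moral for provers: any proof of the crux uses `2 ≤ r_an(W)` only to exclude `r_an(W) = 0`; the
threshold may be read as `1 ≤`.
-/

noncomputable section

-- D-0017: single-problem summit, so `Summit.BirchSwinnertonDyer.BirchSwinnertonDyer.…` repeats a
-- namespace BY DESIGN.
set_option linter.dupNamespace false

namespace Summit.BirchSwinnertonDyer.BirchSwinnertonDyer.Theorems.TwistSupply.Negative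

open Summit.BirchSwinnertonDyer.BirchSwinnertonDyer.Theses.PlecticLegs
open WeierstrassCurve Literature.NumberTheory.EllipticCurves

/-- In `ℚ(ζ_m)/ℚ` (Galois) the fixed field of the whole automorphism group is `ℚ`. [folklore] -/
theorem fixedField_top_cyclotomicField_eq_bot (m : ℕ) [NeZero m] :
    IntermediateField.fixedField (⊤ : Subgroup (CyclotomicField m ℚ ≃ₐ[ℚ] CyclotomicField m ℚ))
      = ⊥ := by
  -- the instance `IsCyclotomicExtension {m} ℚ (CyclotomicField m ℚ)` is declared under
  -- `backward.isDefEq.respectTransparency false` and is not found by synthesis here: name it.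
  haveI : IsGalois ℚ (CyclotomicField m ℚ) :=
    @IsCyclotomicExtension.isGalois {m} ℚ (CyclotomicField m ℚ) _ _ _
      (CyclotomicField.isCyclotomicExtension m ℚ)
  rw [← IntermediateField.fixingSubgroup_bot, IsGalois.fixedField_fixingSubgroup]

/-- **Degree `0` is impossible.** The conclusion of `PlecticLegs.TwistSupply` at degree `0` (its
`W.analyticRank` replaced by `0`) is unsatisfiable for every curve: a fixed field inside `ℚ(ζ_m)`
has positive degree over `ℚ`. The `L`-value clause is never reached. [folklore] -/
theorem twistSupply_conclusion_false_at_degree_zero (W : WeierstrassCurve ℚ) :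
    ¬ ∃ (m : ℕ) (_ : NeZero m), ∃ H : Subgroup (CyclotomicField m ℚ ≃ₐ[ℚ] CyclotomicField m ℚ),
        NumberField.IsTotallyReal ↥(IntermediateField.fixedField H) ∧
        Module.finrank ℚ ↥(IntermediateField.fixedField H) = 0 ∧
        ∀ χ : DirichletCharacter ℂ m,
          (∀ σ ∈ H, ∀ a : ℕ, (∀ z : CyclotomicField m ℚ, z ^ m = 1 → σ z = z ^ a) →
            χ (a : ZMod m) = 1) → χ ≠ 1 →
          ∃ L : ℂ → ℂ, Differentiable ℂ L ∧
            (∀ s : ℂ, 2 < s.re → L s = LSeries (fun n ↦ χ n * ((W.LFunction n : ℤ) : ℂ)) s) ∧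
            L 1 ≠ 0 := by
  rintro ⟨m, hm, H, -, h0, -⟩
  have hpos : 0 < Module.finrank ℚ ↥(IntermediateField.fixedField H) := Module.finrank_pos
  omega

/-- **Degree `1` is free.** The conclusion of `PlecticLegs.TwistSupply` at degree `1` holds for
every curve, with no input about `L`-values: `m = 1`, `H = ⊤`, fixed field `ℚ` (totally real of
degree `1`), and every Dirichlet character of level `1` is trivial, so the twist clause is vacuous.
[folklore] -/
theorem twistSupply_conclusion_at_degree_one (W : WeierstrassCurve ℚ) :
    ∃ (m : ℕ) (_ : NeZero m), ∃ H : Subgroup (CyclotomicField m ℚ ≃ₐ[ℚ] CyclotomicField m ℚ),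
        NumberField.IsTotallyReal ↥(IntermediateField.fixedField H) ∧
        Module.finrank ℚ ↥(IntermediateField.fixedField H) = 1 ∧
        ∀ χ : DirichletCharacter ℂ m,
          (∀ σ ∈ H, ∀ a : ℕ, (∀ z : CyclotomicField m ℚ, z ^ m = 1 → σ z = z ^ a) →
            χ (a : ZMod m) = 1) → χ ≠ 1 →
          ∃ L : ℂ → ℂ, Differentiable ℂ L ∧
            (∀ s : ℂ, 2 < s.re → L s = LSeries (fun n ↦ χ n * ((W.LFunction n : ℤ) : ℂ)) s) ∧
            L 1 ≠ 0 := by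
  refine ⟨1, inferInstance, ⊤, ?_, ?_, ?_⟩
  · rw [fixedField_top_cyclotomicField_eq_bot]
    infer_instance
  · rw [fixedField_top_cyclotomicField_eq_bot]
    exact IntermediateField.finrank_bot
  · intro χ _ hne
    exact absurd (DirichletCharacter.level_one χ) hne

/-- **Mutation: the threshold `2 ≤ r_an` may be read as `1 ≤ r_an`.** From `TwistSupply` one gets
its own conclusion for every elliptic `W/ℚ` with `1 ≤ r_an(W)` (degree `1` being free by
`twistSupply_conclusion_at_degree_one`). The converse is trivial, so the two thresholds give
equivalent statements; the hypothesis does no work at `r_an(W) = 1`. [folklore] -/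
theorem twistSupply_imp_of_one_le_analyticRank (hT : TwistSupply) (W : WeierstrassCurve ℚ)
    [W.IsElliptic] (h1 : 1 ≤ W.analyticRank) :
    ∃ (m : ℕ) (_ : NeZero m), ∃ H : Subgroup (CyclotomicField m ℚ ≃ₐ[ℚ] CyclotomicField m ℚ),
        NumberField.IsTotallyReal ↥(IntermediateField.fixedField H) ∧
        Module.finrank ℚ ↥(IntermediateField.fixedField H) = W.analyticRank ∧
        ∀ χ : DirichletCharacter ℂ m,
          (∀ σ ∈ H, ∀ a : ℕ, (∀ z : CyclotomicField m ℚ, z ^ m = 1 → σ z = z ^ a) →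
            χ (a : ZMod m) = 1) → χ ≠ 1 →
          ∃ L : ℂ → ℂ, Differentiable ℂ L ∧
            (∀ s : ℂ, 2 < s.re → L s = LSeries (fun n ↦ χ n * ((W.LFunction n : ℤ) : ℂ)) s) ∧
            L 1 ≠ 0 := by
  rcases Nat.lt_or_ge W.analyticRank 2 with hlt | hge
  · have h1' : W.analyticRank = 1 := by omega
    rw [h1']
    exact twistSupply_conclusion_at_degree_one W
  · exact hT W hge

/-- **The crux with its hypothesis dropped forces `r_an ≠ 0` everywhere**: if the conclusion of
`TwistSupply` held for every elliptic `W/ℚ` at degree `r_an(W)`, no elliptic curve over `ℚ` could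
have analytic rank `0` (`twistSupply_conclusion_false_at_degree_zero`). [folklore] -/
theorem forall_analyticRank_ne_zero_of_twistSupply_without_rank
    (h : ∀ (W : WeierstrassCurve ℚ) [W.IsElliptic],
      ∃ (m : ℕ) (_ : NeZero m), ∃ H : Subgroup (CyclotomicField m ℚ ≃ₐ[ℚ] CyclotomicField m ℚ),
        NumberField.IsTotallyReal ↥(IntermediateField.fixedField H) ∧
        Module.finrank ℚ ↥(IntermediateField.fixedField H) = W.analyticRank ∧
        ∀ χ : DirichletCharacter ℂ m,
          (∀ σ ∈ H, ∀ a : ℕ, (∀ z : CyclotomicField m ℚ, z ^ m = 1 → σ z = z ^ a) →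
            χ (a : ZMod m) = 1) → χ ≠ 1 →
          ∃ L : ℂ → ℂ, Differentiable ℂ L ∧
            (∀ s : ℂ, 2 < s.re → L s = LSeries (fun n ↦ χ n * ((W.LFunction n : ℤ) : ℂ)) s) ∧
            L 1 ≠ 0)
    (W : WeierstrassCurve ℚ) [W.IsElliptic] : W.analyticRank ≠ 0 := by
  intro h0
  have hW := h W
  rw [h0] at hW
  exact twistSupply_conclusion_false_at_degree_zero W hW

/-- **`TwistSupply` without its hypothesis is false as soon as ONE elliptic curve over `ℚ` of
analytic rank `0` is available** — "any proof of the crux must use `2 ≤ r_an(W)`, but only to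
exclude `r_an(W) = 0`". [folklore] -/
theorem twistSupply_false_without_rank_of_exists_analyticRank_zero
    (hex : ∃ (W : WeierstrassCurve ℚ), W.IsElliptic ∧ W.analyticRank = 0) :
    ¬ ∀ (W : WeierstrassCurve ℚ) [W.IsElliptic],
      ∃ (m : ℕ) (_ : NeZero m), ∃ H : Subgroup (CyclotomicField m ℚ ≃ₐ[ℚ] CyclotomicField m ℚ),
        NumberField.IsTotallyReal ↥(IntermediateField.fixedField H) ∧
        Module.finrank ℚ ↥(IntermediateField.fixedField H) = W.analyticRank ∧
        ∀ χ : DirichletCharacter ℂ m,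
          (∀ σ ∈ H, ∀ a : ℕ, (∀ z : CyclotomicField m ℚ, z ^ m = 1 → σ z = z ^ a) →
            χ (a : ZMod m) = 1) → χ ≠ 1 →
          ∃ L : ℂ → ℂ, Differentiable ℂ L ∧
            (∀ s : ℂ, 2 < s.re → L s = LSeries (fun n ↦ χ n * ((W.LFunction n : ℤ) : ℂ)) s) ∧
            L 1 ≠ 0 := by
  intro h
  obtain ⟨W, hW, h0⟩ := hex
  exact forall_analyticRank_ne_zero_of_twistSupply_without_rank h W h0

/-- **An analytic-rank-`0` curve from the catalogued Hoffstein–Luo fact** (J. Hoffstein, W. Luo,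
Math. Res. Lett. 4 (1997), Theorem; tree fact `HoffsteinLuo1997_exists_twist_L_one_ne_zero`): a
quadratic twist `E^{(d)}` of `ofJ 0` with `L(E^{(d)}, 1) ≠ 0`, hence `r_an(E^{(d)}) = 0` — the last
step unconditional: Mathlib's `analyticOrderAt f z₀ = 0` as soon as `f z₀ ≠ 0`
(`analyticOrderAt_eq_zero`), with or without a continuation. [cite: HoffsteinLuo1997, Theorem] -/
theorem exists_analyticRank_zero_of_hoffsteinLuo
    (hHL : HoffsteinLuo1997_exists_twist_L_one_ne_zero) :
    ∃ (W : WeierstrassCurve ℚ), W.IsElliptic ∧ W.analyticRank = 0 := by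
  obtain ⟨d, hsq, -, -, -, hL⟩ := hHL.exists (WeierstrassCurve.ofJ (0 : ℚ)) ∅
  have hd : (d : ℚ) ≠ 0 := by
    have : d ≠ 0 := fun h ↦ by
      rw [h] at hsq
      exact not_squarefree_zero hsq
    exact_mod_cast this
  refine ⟨(WeierstrassCurve.ofJ (0 : ℚ)).quadraticTwist (d : ℚ),
    WeierstrassCurve.isElliptic_quadraticTwist _ hd, ?_⟩
  unfold WeierstrassCurve.analyticRank analyticOrderNatAt
  rw [analyticOrderAt_eq_zero.mpr (Or.inr hL)]
  rfl

/-- **Load-bearing lemma modulo a catalogued analytic fact.** Hoffstein–Luo 1997 — the `r = 2`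
input of the crux itself — refutes the hypothesis-free crux. [cite: HoffsteinLuo1997, Theorem] -/
theorem twistSupply_false_without_rank_of_hoffsteinLuo
    (hHL : HoffsteinLuo1997_exists_twist_L_one_ne_zero) :
    ¬ ∀ (W : WeierstrassCurve ℚ) [W.IsElliptic],
      ∃ (m : ℕ) (_ : NeZero m), ∃ H : Subgroup (CyclotomicField m ℚ ≃ₐ[ℚ] CyclotomicField m ℚ),
        NumberField.IsTotallyReal ↥(IntermediateField.fixedField H) ∧
        Module.finrank ℚ ↥(IntermediateField.fixedField H) = W.analyticRank ∧
        ∀ χ : DirichletCharacter ℂ m,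
          (∀ σ ∈ H, ∀ a : ℕ, (∀ z : CyclotomicField m ℚ, z ^ m = 1 → σ z = z ^ a) →
            χ (a : ZMod m) = 1) → χ ≠ 1 →
          ∃ L : ℂ → ℂ, Differentiable ℂ L ∧
            (∀ s : ℂ, 2 < s.re → L s = LSeries (fun n ↦ χ n * ((W.LFunction n : ℤ) : ℂ)) s) ∧
            L 1 ≠ 0 :=
  twistSupply_false_without_rank_of_exists_analyticRank_zero
    (exists_analyticRank_zero_of_hoffsteinLuo hHL)

/-- **What the dropped hypothesis would smuggle in**: the hypothesis-free crux would prove the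
entire continuation of `L(W, s)` for EVERY elliptic `W/ℚ` (`WeierstrassCurve.hasEntireLFunction_rat`,
in print only via modularity) — since it forces `r_an(W) ≠ 0`, and the tree disposes of the junk
branch unconditionally (`hasEntireLFunction_of_analyticRank_ne_zero`: no continuation ⇒ `r_an = 0`).
[folklore] -/
theorem hasEntireLFunction_rat_of_twistSupply_without_rank
    (h : ∀ (W : WeierstrassCurve ℚ) [W.IsElliptic],
      ∃ (m : ℕ) (_ : NeZero m), ∃ H : Subgroup (CyclotomicField m ℚ ≃ₐ[ℚ] CyclotomicField m ℚ),
        NumberField.IsTotallyReal ↥(IntermediateField.fixedField H) ∧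
        Module.finrank ℚ ↥(IntermediateField.fixedField H) = W.analyticRank ∧
        ∀ χ : DirichletCharacter ℂ m,
          (∀ σ ∈ H, ∀ a : ℕ, (∀ z : CyclotomicField m ℚ, z ^ m = 1 → σ z = z ^ a) →
            χ (a : ZMod m) = 1) → χ ≠ 1 →
          ∃ L : ℂ → ℂ, Differentiable ℂ L ∧
            (∀ s : ℂ, 2 < s.re → L s = LSeries (fun n ↦ χ n * ((W.LFunction n : ℤ) : ℂ)) s) ∧
            L 1 ≠ 0) :
    WeierstrassCurve.hasEntireLFunction_rat := by
  intro W _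
  exact W.hasEntireLFunction_of_analyticRank_ne_zero
    (forall_analyticRank_ne_zero_of_twistSupply_without_rank h W)

end Summit.BirchSwinnertonDyer.BirchSwinnertonDyer.Theorems.TwistSupply.Negative

end
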